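import Summits.HodgeConjecture.HodgeConjecture.Theorems.ThreefoldSquareCodimTwoRegular
import Literature.AlgebraicGeometry.HodgeTheory.SupportedClassesOfChowZeroSupportedAboveDim
import Literature.AlgebraicGeometry.HodgeTheory.SupportedClassesSemipurity
import Literature.AlgebraicGeometry.Motives.RationallyChainConnected
import Literature.AlgebraicGeometry.Motives.FanoRationallyChainConnected
import HarnessLib

/-!
# Every class of `H⁴(X × X; ℂ)` is algebraic for a smooth projective threefold `X` with `CH₀(X)` supported on a point —
# rationally (chain) connected threefolds unconditionally, Fano threefolds modulo Kollár–Miyaoka–Mori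
# (cell `hodge-nonav`, sector SQ3, row «(2,2)-classes on X × X for every rationally connected threefold X»)

PROVENANCE. Cell hodge-nonav (HUMAN RULING D-0038), planner p1 g35 assignment (iii) (STATUS 2026-08-28T05:47:04Z: the pay-off row
"`(2,2)`-classes on `X × X` for every rationally connected threefold `X`"), prover seat `hodge-nonav-20241-p1` (g10). SUPPORT FILE
(`--supports stmt-HodgeConjecture-19654 --as helper`). The planner anticipated the row modulo {`B⋆(X)`, Debarre's uniruled fact,
Bertini, the Künneth-projector converse}; it holds WITHOUT any of these, by the regular-locus theorem of
`Theorems/ThreefoldSquareCodimTwoRegular` (`algebraicClasses_sq_two_eq_top`: `b₁ = 0`, `H² = N¹H²`, `H⁴ = N²H⁴` ⇒ `H⁴(X × X) = N²`) once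
its three hypotheses are read off `CH₀`:

* `H¹(X(ℂ); ℂ) = N¹H¹ = 0` and `H²(X(ℂ); ℂ) = N¹H²` — Bloch–Srinivas: `CH₀(X)` supported in dimension `≤ d` ⇒ `N¹Hˡ = Hˡ` for all `l > d`
  (tree theorem `supportedClasses_eq_top_of_hasChowZeroSupportedInDimLE_of_lt`, decomposition of the diagonal) and semipurity
  `N¹H¹ = 0` (`supportedClasses_eq_bot_of_lt`);
* `H⁴(X(ℂ); ℂ) = N²H⁴` — hard Lefschetz `L : H² ≅ H⁴` for the hyperplane class and `L(N¹H²) ⊆ N²H⁴` (`[H] ∪ [Z] = [H · Z]`; the fields of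
  the tree's `HardLefschetzNFold`, a theorem of the tree `nonempty_hardLefschetzNFold_holds`).

CONTENT (sorry-free over tree theorems; no definition, no named fact):
`subsingleton_complexBetti_one_of_hasChowZeroSupportedInDimLE_zero`, `algebraicClasses_one_eq_top_of_hasChowZeroSupportedInDimLE_zero`,
`algebraicClasses_two_eq_top_of_hasChowZeroSupportedInDimLE_zero`, **`algebraicClasses_sq_two_eq_top_of_hasChowZeroSupportedInDimLE_zero`**
(EVERY class of `H⁴((X ⊗ X)(ℂ); ℂ)` is algebraic), `hodgeTwoTwo_sq_of_hasChowZeroSupportedInDimLE_zero` (the row, in the shape of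
`LefschetzStandardShadows.HodgeCodimTwoSquaresOfThreefolds` at `X`), `…_of_isRationallyChainConnected` (rationally chain connected
threefolds, UNCONDITIONAL), `…_of_isFano` (smooth Fano threefolds, modulo the named fact `KollarMiyaokaMori1992_fano_rationallyChainConnected`).

HONEST SCOPE. Rationally connected threefolds have no transcendental cohomology in degrees `≤ 2` and `≥ 4`, so the codimension-2 classes of
the square are governed by `N¹ ⊗ N¹` and the algebraic `H⁰ ⊗ H⁴`, `H⁴ ⊗ H⁰`; the theorem says nothing about `H³(X) ⊗ H³(X) ⊂ H⁶(X × X)`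
(codimension 3, where the intermediate Jacobian lives). Nothing here proves the Hodge conjecture for a new class beyond this; rung F-H1 not
moved.

## References

* [BlochSrinivas1983] S. Bloch, V. Srinivas, Remarks on correspondences and algebraic cycles, Amer. J. Math. 105 (1983), Thm. 1.
* [VoisinHodgeII2003] C. Voisin, Hodge Theory and Complex Algebraic Geometry II (2003), Thm. 10.17, Cor. 10.18, Prop. 9.20.
* [VoisinHodgeI2002] C. Voisin, Hodge Theory and Complex Algebraic Geometry I (2002), Thm. 6.25, §7.1.2.
* [KollarMiyaokaMori1992] J. Kollár, Y. Miyaoka, S. Mori, J. Differential Geom. 36 (1992), Thm. 0.1.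
* [Kollar1995] J. Kollár, Rational curves on algebraic varieties (1996), Def. IV.3.2 / 4.10.
-/

set_option linter.dupNamespace false

noncomputable section

open CategoryTheory AlgebraicGeometry MonoidalCategory CartesianMonoidalCategory
open Literature.AlgebraicTopology.SingularHomology
open Literature.AlgebraicGeometry Literature.AlgebraicGeometry.Motives Literature.AlgebraicGeometry.HodgeTheory
open Literature.Barriers.HodgeConjecture
open Summit.HodgeConjecture.HodgeConjecture.Theorems

namespace Summit.HodgeConjecture.HodgeConjecture.Theorems.ThreefoldSquare

variable {X : SchemeOver ℂ}

/-- **`H¹(X(ℂ); ℂ) = 0` when `CH₀(X)` is supported on a point** (any smooth projective `X` of dimension `n`): Bloch–Srinivas gives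
`N¹H¹ = H¹`, and `N¹H¹ = 0` by semipurity. [cite: BlochSrinivas1983, Thm. 1 (proof)] [cite: VoisinHodgeII2003, Thm. 10.17 and Cor. 10.18] -/
theorem subsingleton_complexBetti_one_of_hasChowZeroSupportedInDimLE_zero {n : ℕ} (hX : IsSmoothProjective n X)
    (hW : HasChowZeroSupportedInDimLE X 0) : Subsingleton (complexBetti X 1) := by
  have htop : supportedClasses X 1 1 = ⊤ := supportedClasses_eq_top_of_hasChowZeroSupportedInDimLE_of_lt hX hW (by norm_num)
  have hbot : supportedClasses X 1 1 = ⊥ := supportedClasses_eq_bot_of_lt hX (by norm_num)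
  refine subsingleton_of_forall_eq 0 fun y ↦ ?_
  have hy : y ∈ supportedClasses X 1 1 := by rw [htop]; exact Submodule.mem_top
  rw [hbot] at hy
  exact (Submodule.mem_bot ℂ).1 hy

/-- **`H²(X(ℂ); ℂ) = N¹H²` when `CH₀(X)` is supported on a point** (Bloch–Srinivas, `l = 2 > 0`).
[cite: BlochSrinivas1983, Thm. 1 (proof)] [cite: VoisinHodgeII2003, Thm. 10.17 and Cor. 10.18] -/
theorem algebraicClasses_one_eq_top_of_hasChowZeroSupportedInDimLE_zero {n : ℕ} (hX : IsSmoothProjective n X)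
    (hW : HasChowZeroSupportedInDimLE X 0) : algebraicClasses X 1 = ⊤ :=
  supportedClasses_eq_top_of_hasChowZeroSupportedInDimLE_of_lt hX hW (by norm_num)

/-- **`H⁴(X(ℂ); ℂ) = N²H⁴` for a THREEFOLD with `CH₀` supported on a point**: hard Lefschetz `L : H² ≅ H⁴` for the hyperplane class
(`HardLefschetzNFold`) and `L(N¹H²) ⊆ N²H⁴` (`L_mem_algebraicClasses_of_mem`), with `N¹H² = H²` from Bloch–Srinivas.
[cite: VoisinHodgeI2002, Thm. 6.25 and §7.1.2] [cite: VoisinHodgeII2003, §9.2.4 Prop. 9.20] -/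
theorem algebraicClasses_two_eq_top_of_hasChowZeroSupportedInDimLE_zero (hX : IsSmoothProjective 3 X)
    (hW : HasChowZeroSupportedInDimLE X 0) : algebraicClasses X 2 = ⊤ := by
  obtain ⟨Λ⟩ := nonempty_hardLefschetzNFold_holds 3 X hX
  have h₂ := algebraicClasses_one_eq_top_of_hasChowZeroSupportedInDimLE_zero hX hW
  have key : ∀ y : complexBetti X (2 * (1 + 1)), y ∈ algebraicClasses X (1 + 1) := fun y ↦ by
    obtain ⟨x, rfl⟩ := (Λ.bijective_L (j := 1) (k := 2 * 1) (by norm_num) (2 * (1 + 1)) (by norm_num)).2 y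
    exact Λ.L_mem_algebraicClasses_of_mem 1 1 (by norm_num) (by rw [h₂]; exact Submodule.mem_top)
  exact eq_top_iff.2 fun y _ ↦ key y

/-- **ROW (KERNEL): for a smooth projective THREEFOLD `X` with `CH₀(X)` supported on a point, EVERY class of `H⁴((X ⊗ X)(ℂ); ℂ)` is
algebraic** — `b₁ = 0`, `H² = N¹`, `H⁴ = N²` read off `CH₀`, then `algebraicClasses_sq_two_eq_top` (Künneth slots). (statement: cell hodge-nonav
sector SQ3 row RC; a corollary of Bloch–Srinivas + hard Lefschetz + Künneth, assembled here) [cite: BlochSrinivas1983, Thm. 1]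
[cite: VoisinHodgeII2003, proof of Prop. 9.20] -/
theorem algebraicClasses_sq_two_eq_top_of_hasChowZeroSupportedInDimLE_zero (hX : IsSmoothProjective 3 X)
    (hW : HasChowZeroSupportedInDimLE X 0) : algebraicClasses (X ⊗ X) 2 = ⊤ :=
  algebraicClasses_sq_two_eq_top hX (subsingleton_complexBetti_one_of_hasChowZeroSupportedInDimLE_zero hX hW)
    (algebraicClasses_one_eq_top_of_hasChowZeroSupportedInDimLE_zero hX hW)
    (algebraicClasses_two_eq_top_of_hasChowZeroSupportedInDimLE_zero hX hW)

/-- **The rational `(2,2)`-classes of `X × X` are algebraic for a smooth projective threefold with `CH₀` supported on a point** — the body of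
`LefschetzStandardShadows.HodgeCodimTwoSquaresOfThreefolds` at `X`. [cite: BlochSrinivas1983, Thm. 1] [cite: VoisinHodgeII2003, proof of Prop. 9.20] -/
theorem hodgeTwoTwo_sq_of_hasChowZeroSupportedInDimLE_zero (hX : IsSmoothProjective 3 X) (hW : HasChowZeroSupportedInDimLE X 0) :
    ∀ c : complexBetti (X ⊗ X) (2 * 2), IsRationalClass c →
      IsOfHodgeType (3 + 3) (X ⊗ X) (2 * 2) 2 2 c → c ∈ algebraicClasses (X ⊗ X) 2 := fun c _ _ ↦ by
  rw [algebraicClasses_sq_two_eq_top_of_hasChowZeroSupportedInDimLE_zero hX hW]; exact Submodule.mem_top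

/-- **Rationally chain connected threefolds, UNCONDITIONALLY**: every class of `H⁴((X ⊗ X)(ℂ); ℂ)` is algebraic
(`IsRationallyChainConnected.hasChowZeroSupportedInDimLE_zero`: `CH₀ = ℤ`). [cite: Kollar1995, Def. IV.3.2 (4.10)]
[cite: BlochSrinivas1983, Thm. 1] -/
theorem algebraicClasses_sq_two_eq_top_of_isRationallyChainConnected (hX : IsSmoothProjective 3 X)
    (hRC : IsRationallyChainConnected X) : algebraicClasses (X ⊗ X) 2 = ⊤ :=
  algebraicClasses_sq_two_eq_top_of_hasChowZeroSupportedInDimLE_zero hX (hRC.hasChowZeroSupportedInDimLE_zero hX)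

/-- The same in the shape of row S19 at `X`: the rational `(2,2)`-classes of the square of a rationally chain connected smooth projective
threefold are algebraic. [cite: Kollar1995, Def. IV.3.2 (4.10)] [cite: BlochSrinivas1983, Thm. 1] -/
theorem hodgeTwoTwo_sq_of_isRationallyChainConnected (hX : IsSmoothProjective 3 X) (hRC : IsRationallyChainConnected X) :
    ∀ c : complexBetti (X ⊗ X) (2 * 2), IsRationalClass c →
      IsOfHodgeType (3 + 3) (X ⊗ X) (2 * 2) 2 2 c → c ∈ algebraicClasses (X ⊗ X) 2 :=
  hodgeTwoTwo_sq_of_hasChowZeroSupportedInDimLE_zero hX (hRC.hasChowZeroSupportedInDimLE_zero hX)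

/-- **Smooth Fano threefolds, modulo Kollár–Miyaoka–Mori** (Fano ⇒ rationally chain connected, named fact
`KollarMiyaokaMori1992_fano_rationallyChainConnected`): every class of `H⁴((X ⊗ X)(ℂ); ℂ)` is algebraic. CONDITIONAL on that fact.
[cite: KollarMiyaokaMori1992, Thm. 0.1] [cite: BlochSrinivas1983, Thm. 1] -/
theorem algebraicClasses_sq_two_eq_top_of_isFano (hK : KollarMiyaokaMori1992_fano_rationallyChainConnected)
    (hF : IsFano 3 X) : algebraicClasses (X ⊗ X) 2 = ⊤ :=
  algebraicClasses_sq_two_eq_top_of_isRationallyChainConnected hF.isSmoothProjective (hK hF)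

end Summit.HodgeConjecture.HodgeConjecture.Theorems.ThreefoldSquare

end
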